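import Mathlib
import HarnessLib
import HarnessLib.Audit
import Summits.MatrixMultiplication.Statement
import Literature.Computability.AlgebraicComplexity.MatrixMultiplicationExponent

/-!
Route: PriceOfSymmetry

CLOSED (retired) 2026-08-15T13:49:02Z by operator:999:1257524 — reason: not-a-thesis: assembly does not conclude the sub-problem Statement — note: D-0027 §2.1 audit (human 2026-08-15: routes that do not decide the summit are removed): the assembly concludes `PriceIsTwoThirds`, not the sub-problem statement; a NEW conforming route may be opened from the same idea (generated `closes : … → _root_.MatrixMultiplication`).. The file is kept as the record of this route; refuted decls are indexed as negative knowledge (`ledger negatives`).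

# Route PriceOfSymmetry — S_n-natural bilinear schemes for ⟨n,n,n⟩ cost Θ(n³) — at least C(n,3),
conjecturally exactly (2/3)n³ (representation-stability barrier, calibrated)

NEGATIVE KNOWLEDGE / CALIBRATION route (realises idea card representation-stability-barrier; it
neither proves nor refutes ω = 2 — stated plainly). Call a bilinear scheme ⟨n,n,n⟩ = Σ_{i<r} w_i ⊗
u_i ⊗ v_i (triads over ℂ, legs indexed by Fin n × Fin n) SYMMETRIC (S_n-natural) if relabelling all
indices by any σ ∈ S_n (e_{ab} ↦ e_{σa σb} on all three legs at once) permutes the list of triads.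
Every "one formula for all n" scheme — the standard algorithm, Grochow–Moore's n³ − n + 1 orbit
family, any FI-uniform family in the card's sense — is symmetric. X = PriceIsTwoThirds: (UPPER)
there are K, n₀ such that for every n ≥ n₀ a symmetric scheme with at most (2/3)n³ + K n² triads
exists, AND (LOWER) there are K, n₀ such that for n ≥ n₀ every symmetric scheme has at least (2/3)n³
− K n² triads. The provable core filed alongside (crux SymmetricSchemesCubic): every symmetric
scheme has ≥ C(n,3) triads for n ≥ n₀, so no construction functorial in n certifies any exponent
below 3; fast algorithms must break S_n down to small subgroups (Strassen^{⊗k} keeps only the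
diagonal (Z_2)^k ⋊ S_k, Pan's aggregation keeps S_{n/2}).
Lean: `(∃ (K : ℝ) (n₀ : ℕ), ∀ n : ℕ, n₀ ≤ n → ∃ (r : ℕ) (w u v : Fin r → Fin n × Fin n → ℂ), (∀ σ :
Equiv.Perm (Fin n), ∃ π : Equiv.Perm (Fin r), ∀ i, ∀ p q s : Fin n × Fin n,
Literature.Computability.AlgebraicComplexity.triad (w (π i)) (u (π i)) (v (π i)) (σ p.1, σ p.2) (σ
q.1, σ q.2) (σ s.1, σ s.2) = Literature.Computability.AlgebraicComplexity.triad (w i) (u i) (v i) p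
q s) ∧ ∑ i, Literature.Computability.AlgebraicComplexity.triad (w i) (u i) (v i) =
Literature.Computability.AlgebraicComplexity.matMulTensor ℂ n n n ∧ (r : ℝ) ≤ (2 / 3 : ℝ) * (n : ℝ)
^ 3 + K * (n : ℝ) ^ 2) ∧ (∃ (K : ℝ) (n₀ : ℕ), ∀ n : ℕ, n₀ ≤ n → ∀ (r : ℕ) (w u v : Fin r → Fin n ×
Fin n → ℂ), (∀ σ : Equiv.Perm (Fin n), ∃ π : Equiv.Perm (Fin r), ∀ i, ∀ p q s : Fin n × Fin n,
Literature.Computability.AlgebraicComplexity.triad (w (π i)) (u (π i)) (v (π i)) (σ p.1, σ p.2) (σ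
q.1, σ q.2) (σ s.1, σ s.2) = Literature.Computability.AlgebraicComplexity.triad (w i) (u i) (v i) p
q s) → ∑ i, Literature.Computability.AlgebraicComplexity.triad (w i) (u i) (v i) =
Literature.Computability.AlgebraicComplexity.matMulTensor ℂ n n n → (2 / 3 : ℝ) * (n : ℝ) ^ 3 - K *
(n : ℝ) ^ 2 ≤ (r : ℝ))`

## Assembly
Pure logic: X is the conjunction of the rank-4 crux (UPPER) and the rank-2 crux (LOWER); `fun h₁ h₂
=> ⟨h₁, h₂⟩` closes it (checked rc 0 in the planner's Sketch.lean). The barrier core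
SymmetricSchemesCubic is proved directly from the three supports (symmetrisation identity Σ_i t_i =
(1/n!) Σ_i Sym t_i for a symmetric list; drop zero triads; SmallOrbitsFewLabels with c = 2 and
FixedTriadFixedLegs give ≤2-label legs; TwoLabelSpanMisses with c_i = 1/n! contradicts) and is
implied, for large n, by PriceOfSymmetryLower.

Rationale: WHY THIS LINE. Mechanism: symmetrise (Reynolds operator Σ_{σ∈S_n} σ·) any symmetric scheme into the
203-dimensional space of S_n-invariants of (ℂ^{n×n})^{⊗3} (orbit basis indexed by the Bell(6) = 203
set partitions of the six index slots — the partition-algebra / FI-module bookkeeping of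
arXiv:1204.4533), where two facts do all the work: (i) terms fixed by the pointwise stabiliser of a
2-set ("≤ 2 labels") symmetrise into a codimension-8 subspace V₂ that misses ⟨n,n,n⟩ — an
n-independent ±1 certificate on 20 patterns, found and verified exactly at n = 6,…,1000 at the
planner's desk (fi/certificate_n_independent.json), replicating the card's rank-195/203 claim
independently; (ii) a term with ≥ 3 labels has an S_n-orbit of size ≥ C(n,3) (DixonMortimer1996 Thm
5.2B: subgroups of index < C(n,3) contain Alt on the complement of ≤ 2 points). Modulo V₂ only the
3×3 label cores of 3-label terms survive (48 = 8·3! nonzero classes), so the LEADING CONSTANT of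
symmetric schemes is a finite design problem over cores with stabilisers H ≤ S_3 and weights 1/|H|:
weight 1/6 (the card's B3) is excluded by an exact linear obstruction, weights 1/3 and 1/2 are
numerically infeasible, and weight 2/3 is SOLVED EXACTLY over Q(ω) by two Z_3-symmetric orbits (six
sparse designs, e.g. cores u=(1,ω,0), v=(1,0,ω−1), w=(0,0,1/3) all of Z_3-character 1 plus u=S
(cyclic shift), v=e₀₂+ω²e₁₀+ωe₂₁, w=((1+2ω)/3)(e₀₂+ωe₁₀+ω²e₂₁); fi/exact_designs.json, verified in
exact Q(ω) arithmetic against the full 203-dimensional model and the integer annihilators) — a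
symmetric analogue of Pan's trilinear aggregation (doi:10.1109/SFCS.1978.34; Landsberg2017 Thm
4.2.1.1, Ex. 4.2.1.3: n³/3 + 6n² − 4n/3 with symmetry only S_{n/2} × Z_2 × S_3, Rem. 4.2.1.2)
sitting between Grochow–Moore's constant 1 (GrochowMoore2016 = arXiv:1612.01527, Landsberg2017 Thm
4.2.2.6) and Pan's 1/3. Imported areas: representation stability / partition-algebra combinatorics
and permutation-group index bounds (algebra) into bilinear complexity; symmetric-circuit lower
bounds (arXiv:2002.06451, support theorems) as the depth-unbounded horizon. What no prior route or
the (empty) negatives index does: a calibration of the whole "uniform formula" class — an anti-Comon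
phenomenon for the diagonal S_n (imposing index symmetry costs Θ(n³), whereas Landsberg2017 §4.1.4
expects optimal decompositions WITH leg symmetry) and a map of how much symmetry any ω-relevant
construction must break.

RANKED CRUXES. #0 PriceIsTwoThirds (target) — X = UPPER ∧ LOWER as in § Thesis: symmetric schemes
with ≤ (2/3)n³ + K n² triads exist for all large n, and every symmetric scheme has ≥ (2/3)n³ − K n²
triads for all large n. (why it might fail: the lower half fails if a weight-1/2 core design exists
(constant 1/2, decidable by Gröbner); the upper half now rests on exact Q(ω) cores and can fail only
in the n-uniform bookkeeping of the 2-label repair layer.) [GrochowMoore2016, Landsberg2017,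
doi:10.1109/SFCS.1978.34, DixonMortimer1996]
#2 PriceOfSymmetryLower (crux) — LOWER: there are K, n₀ such that for n ≥ n₀ every S_n-symmetric
scheme for ⟨n,n,n⟩ has at least (2/3)n³ − K n² triads. Route to it (layer 2, not filed): orbits of
size < C(n,4) are ≤3-label (SmallOrbitsFewLabels with c = 3); modulo the 2-label span V₂ only 3×3
cores count; exclude core designs of total weight 1/6, 1/3, 1/2 (finitely many polynomial systems
over Q(ω); 1/6 already excluded linearly at the desk). [deps: SymmetricSchemesCubic,
SmallOrbitsFewLabels, TwoLabelSpanMisses] [difficulty: L] (why it might fail: a weight-1/2 core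
design (one Z_2-symmetric 3-label orbit, or an S_3-orbit plus a Z_3-orbit) may exist although
Levenberg–Marquardt stalls at residual 0.707 / 0.603 from 40+ random starts (fi/heavy_search.out);
then the constant is 1/2. Decidable by Gröbner over Q(ω).) [GrochowMoore2016,
doi:10.1109/SFCS.1978.34, Landsberg2017, DixonMortimer1996]
#3 SymmetricSchemesCubic (crux) — THE BARRIER CORE (mechanism's theorem, provable now): there is n₀
(expected n₀ = 10) such that for n ≥ n₀ every S_n-symmetric scheme for ⟨n,n,n⟩ has at least C(n,3) =
n(n−1)(n−2)/6 triads. Hence every family of schemes functorial in n has term count ≥ n³/6 − O(n²)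
and certifies no exponent below 3 (card item B1 + CEF corollary). Proof plan: symmetrisation
identity Σ t_i = (1/n!) Σ_i Sym(t_i); if r < C(n,3) all terms are ≤2-label (SmallOrbitsFewLabels c =
2, FixedTriadFixedLegs); contradiction with TwoLabelSpanMisses. [deps: TwoLabelSpanMisses,
SmallOrbitsFewLabels, FixedTriadFixedLegs] [difficulty: M] (why it might fail: rests on the desk
certificate λ (±1 on 20 patterns, verified exactly at n = 6..1000) and on Dixon–Mortimer 5.2B; a
slot-convention slip between the orbit model and matMulTensor, or the n = 8 index-35 exceptions
(S_4≀S_2, AGL(3,2)) leaking past n₀, would break the stated form.) [DixonMortimer1996,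
arXiv:1204.4533, arXiv:2002.06451, GrochowMoore2016]
#4 SymmetricTwoThirdsScheme (crux) — UPPER (new construction, found at the desk, exact over Q(ω)):
there are K, n₀ such that for every n ≥ n₀ there is an S_n-symmetric scheme for ⟨n,n,n⟩ with at most
(2/3)n³ + K n² triads — two S_n-orbits of Z_3-symmetric rank-one 3-label templates (each orbit of
size n(n−1)(n−2)/3; legs are twisted circulants on the 3×3 label core; sparsest design: orbit A with
all legs of Z_3-character 1, (x₀,x₁,x₂) = (1,ω,0), (1,0,ω−1), (0,0,1/3); orbit B with characters
(0,1,2): u = cyclic shift S, v = e₀₂+ω²e₁₀+ωe₂₁, w = ((1+2ω)/3)(e₀₂+ωe₁₀+ω²e₂₁);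
fi/exact_designs.json holds six) plus an O(n²) repair by ≤ 195 orbits of ≤2-label triads realising
the V₂-remainder (fi/verify_exact_full.py: remainder annihilated exactly by all 8 integer λ's).
[deps: TwoLabelSpanMisses] [difficulty: provable-now] (why it might fail: exact Q(ω) cores are in
hand; what can still fail is formal: the V₂-remainder must be expanded in 2-label orbit sums with
coefficients rational in n (finitely many poles, absorbed into n₀), each realised by rank-one triads
counted ≤ K n² — near-zero mathematical risk, real bookkeeping.) [GrochowMoore2016,
doi:10.1109/SFCS.1978.34, Landsberg2017]
#9 TwoLabelSpanMisses (support) — the span theorem with certificate (card B1): for n ≥ 6, no complex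
combination of S_n-symmetrisations of triads whose three legs are all fixed by the pointwise
stabiliser of some 2-set {a,b} equals ⟨n,n,n⟩. Proof: the linear functional Λ(t) = Σ_P λ_P t(i^P) (λ
∈ {0,±1}^{203} supported on 20 set partitions, fi/certificate_n_independent.json; i^P a
representative 6-tuple of pattern P with values in {0,…,5}) kills every symmetrised ≤2-label triad
(1000 orbit-type generators; coordinates are polynomials of degree ≤ 2 in n, so vanishing at three n
proves all n) and Λ(⟨n,n,n⟩) = −1. [difficulty: provable-now] [arXiv:1204.4533, GrochowMoore2016]
#9 SmallOrbitsFewLabels (support) — small orbits force few labels (general tensors, parametric): for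
every c there is n₀ such that for n ≥ n₀, if a list of r < C(n, c+1) order-6 tensors on Fin n is
permuted by every simultaneous index relabelling, then each tensor is fixed by the pointwise
stabiliser of some set of ≤ c indices. Proof: the set of distinct tensors is S_n-stable, orbits have
size ≤ r, so stabilisers have index < C(n,c+1) and contain Alt on the complement of ≤ c points
(DixonMortimer1996 Thm 5.2A/B, c+1 ≤ n/2, exceptions only for n ≤ 8); Alt-fixed ⇒ Sym-fixed for
order-6 tensors once n − c ≥ 8. [difficulty: M] [DixonMortimer1996]
#9 FixedTriadFixedLegs (support) — for n ≥ 6, a NONZERO triad w ⊗ u ⊗ v (legs on Fin n × Fin n)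
fixed as a tensor by every σ in the pointwise stabiliser of {a,b} has each leg fixed by that
stabiliser (the legs transform by characters of Sym([n]∖{a,b}) with product 1, and the sign
character does not occur in ℂ^{[n]²} once n − 2 ≥ 4). [difficulty: provable-now] [DixonMortimer1996]

TWO-LAYER PLAN. Foreseen glued splits (k ≤ 3, depth 1), filed only when a crux closes:
SymmetricSchemesCubic ⇐ TwoLabelSpanMisses → SmallOrbitsFewLabels → SymmetricSchemesCubic (glue =
symmetrisation identity + FixedTriadFixedLegs); PriceOfSymmetryLower ⇐ CoreDesignReduction (mod-V₂
reduction of the leading constant to 3×3 core designs with weights 1/|H|; provable now, same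
certificate technology) → WeightHalfInfeasible (no core design of total weight ≤ 1/2: three
polynomial systems over Q(ω), Gröbner / Nullstellensatz certificates) → PriceOfSymmetryLower;
SymmetricTwoThirdsScheme ⇐ ExactCoreDesign (two Z_3-fixed rank-one cores over Q(ω) solving Σ_j
Θ(core_j)/3 = e_τ) → RepairLayer (the V₂-remainder is an S_n-invariant multiset of ≤ 195·n²
two-label triads) → SymmetricTwoThirdsScheme.

KILL CRITERIA. TwoLabelSpanMisses refuted (an explicit ≤2-label symmetrised expression of ⟨n,n,n⟩
for some n ≥ 6) or SymmetricSchemesCubic refuted (symmetric schemes with o(n³)… fewer than C(n,3)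
triads for infinitely many n) ⇒ close `refuted:SymmetricSchemesCubic` — the line and the card die
together. PriceOfSymmetryLower refuted by a weight-1/2 design ⇒ pivot, not death: restate
LOWER/UPPER and the target with constant 1/2 (the design is itself the news: a uniform symmetric
algorithm with n³/2 + O(n²) products). SymmetricTwoThirdsScheme refuted (no exact lift) ⇒ restate
UPPER with the best liftable weight and the target accordingly. Nothing proved elsewhere moots the
route: it is independent of the value of ω.

NOT DECOMPOSED YET. Deliberately left for layer 2 / supports-by-provers: the core-design reduction
lemma and the Gröbner infeasibility certificates (children of PriceOfSymmetryLower); the exact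
algebraic templates and the repair layer (children of SymmetricTwoThirdsScheme); the explicit n₀
(expected 10) and the Dixon–Mortimer index lemma as a --supports lemma; the border/degeneration
version (Λ is continuous and V₂ closed, so symmetric APPROXIMATE schemes also need ≥ C(n,3) — a
corollary, not filed); the FI-degree-shifted version (schemes natural only in n − k of the indices
still need ≥ C(n−k,3)); A_n in place of S_n (same proof); optimality of Grochow–Moore's n³ − n + 1
among S_{n+1}-symmetric (standard irrep) schemes; the real-field constant (the weight-2/3 designs
found are complex; over ℝ a Z_3-fixed rank-one template is circulant and pairs of those fail
numerically, so the real constant may be 1); the depth-unbounded version for S_n-symmetric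
arithmetic circuits (filed after open as an informal crux, needs a SymmetricArithmeticCircuit
definition after arXiv:2002.06451).

CHEAPEST FALSIFIER. (1) Re-run the two 1-second desk scripts fi/span_check.py and fi/kernel_exact.py
(pure Python, no dependencies): rank V₂ = 195/203 mod two primes at n = 50, quotient spanned by the
8 triangle patterns, and the integer certificate λ ⊥ V₂ exactly at n = 6,7,8,9,10,13,50,1000 with
λ·⟨n,n,n⟩ = −1 — DONE, all pass; a refuter should re-derive λ from scratch with an independent slot
convention (the card's own computation, a third implementation, agrees on 195/203 and
non-membership). (2) A Gröbner-basis run (kit: msolve/Singular, minutes) on the weight-1/2 core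
systems (Z_2 single orbit: legs in the ± eigenspaces of M_3(ℂ), dims 5/4; S_3 + Z_3 pair) decides
the rank-2 crux's constant outright. (3) fi/exact_lift3.py + fi/verify_exact_full.py (seconds)
reproduce and exactly verify the weight-2/3 designs; the rank-4 crux then needs only the
repair-layer bookkeeping.

NUMBERS. Standard algorithm: n³ triads, symmetric (one free 3-label orbit n(n−1)(n−2) + three
2-label orbits + one 1-label orbit). GrochowMoore2016 (Landsberg2017 Thm 4.2.2.6): n³ − n + 1,
symmetric under S_{n+1} ⊃ S_n (standard irrep restricted to S_n = permutation representation,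
simplex basis). Pan 1978 (Landsberg2017 Thm 4.2.1.1, Ex. 4.2.1.3, Rem. 4.2.1.2 after Burichenko):
n³/3 + 6n² − 4n/3 with symmetry group S_{n/2} × Z_2 × S_3 — NOT S_n-symmetric. Strassen: 7 terms,
invariant under the diagonal index swap Z_2 ⊂ PGL_2^{×3} (Landsberg2017 §4.3, arXiv:1408.6273), so
Strassen^{⊗k} (7^k = n^{2.807} terms, n = 2^k) is invariant under the regular elementary-abelian
(Z_2)^k ⋊ S_k ≤ S_n: symmetry under a regular abelian subgroup does not force cubic cost, full S_n
does. Desk numbers (folder fi/): dim Inv = Bell(6) = 203; dim V₂ = 195 for every n ≥ 6 (annihilator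
n-independent); certificate support 20, entries ±1, λ·⟨n,n,n⟩ = −1; quotient basis = 8 triangle
patterns; nonzero core classes 48 = 8·3!; feasible design weights found: 2/3 (Z_3+Z_3, 68 of 81
character pairs numerically; six EXACT sparse designs over Q(ω) with 7–10 of 18 core parameters
zero), 5/6, 1; infeasible: 1/6 (exact), 1/3, 1/2 (numerical, plateaux 0.7071, 0.6030, 0.3536).
Bounds at filing: C(n,3) ≤ min symmetric length ≤ (2/3)n³ + O(n²) (exact cores + linear repair),
conjectured = (2/3)n³ + O(n²).

DEFINITION REQUESTS. None for the typed items (triad, matMulTensor, Equiv.Perm suffice; the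
symmetric-scheme predicate is inlined). For the informal depth-unbounded crux filed after open:
definition SymmetricArithmeticCircuit (Γ-symmetric arithmetic circuit in the sense of
Dawar–Wilsenach, arXiv:2002.06451 §3) under Literature/Computability/AlgebraicComplexity. Bib:
Pan1978 (doi:10.1109/SFCS.1978.34), Burichenko2014 (arXiv:1408.6273), ChurchEllenbergFarb2015
(arXiv:1204.4533), DawarWilsenach2020 (arXiv:2002.06451) — `ledger bib add` timed out twice at
filing (service hang); DOIs/arXiv ids used as sources meanwhile.

Novelty: Searches (2026-08-15): `lit search --hybrid "symmetric matrix multiplication algorithm group orbit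
invariant decomposition"` (10 docs; hit: Landsberg2017 §4.1–4.3, read pp. 84–96); `lit read
arXiv:1612.01527` (Grochow–Moore, full text, 16 pp.); `lit search --source zbmath "symmetric
circuits matrix multiplication"` (12, none relevant); `lit search --source crossref "symmetric
circuits determinant Dawar"` (12: Anderson–Dawar 2016, Dawar–Wilsenach rank logic 2021,
Atserias–Dawar–Ochremiak 2019 — symmetric circuits/LPs, none on MaMu); arXiv / Semantic Scholar /
OpenAlex API calls rate-limited (HTTP 429) and `lit galaxy search "symmetric circuits matrix
multiplication" --star all` / `"symmetric algorithms for matrix multiplication"` saturated (> 90 s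
queue) twice — logged, not retried further; ledger negatives (0); the card's own audit refs
(arXiv:1204.4533, 1309.3817, 1408.6273, 1610.08364, 1801.00843, 2002.06451).
Nearest prior art found: GrochowMoore2016 = arXiv:1612.01527 (symmetric group-ORBIT decompositions;
the uniform n³ − n + 1 family; constructions only, no lower bounds); Pan 1978 via Landsberg2017 Thm
4.2.1.1 / Rem 4.2.1.2 (aggregation: n³/3 + 6n² − 4n/3 with symmetry S_{n/2} × Z_2 × S_3);
Landsberg2017 §4.1 (symmetry groups Γ_S of decompositions, generalized Comon conjecture BILR:
optimal decompositions with leg symmetry should exist); arXiv:2002.06451 (Dawar–Wilsenach symmetric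
arithmetic circuits: support theorem, exponential bound for the permanent — the complexity  [refs: 1612.01527, 1204.4533, 2002.06451, Landsberg2017, GrochowMoore2016]

Barriers (technique_class: natural-scheme, representation-stability): - technique_class: natural-scheme, representation-stability
- Literature.Barriers.MatrixMultiplication.LinearRankMethodBarrier: does not apply — the route
bounds only SYMMETRIC schemes, via a linear functional on the 203-dimensional S_n-invariant subspace
after Reynolds symmetrisation plus orbit counting; it is not a rank/flattening/determinantal method
on ⟨n,n,n⟩ and asserts nothing about R(⟨n,n,n⟩) (consistent with the 8n² cap on rank methods); the
bet is precisely that symmetry, not rank, is the resource.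
- Literature.Barriers.MatrixMultiplication.InfimumNotMinimumBarrier: orthogonal — no claim on ω is
made; the route calibrates a class of constructions (every S_n-natural family has exponent exactly
3, constant in [1/6, 2/3]… conjecturally 2/3), complementary to CW82's "no basic algorithm attains
ω".
- Negatives index: empty at filing (ledger negatives --problem MatrixMultiplication: 0 refuted
statements).

History (route lifecycle, newest last):
- 2026-08-15T13:49:02Z · CLOSED retired — not-a-thesis: assembly does not conclude the sub-problem Statement (operator:999:1257524)

sub-problem: MatrixMultiplication · status: closed(retired) · opened planner-plancard-MatrixMultiplication-MatrixM-24c261c3-0 2026-08-15T11:53:17Z · rev 0 · ledger route-MatrixMultiplication-PriceOfSymmetry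
GENERATED by the gate from the ledger (D-0016/17). Provers cite these decls: `theorem foo : Summit.MatrixMultiplication.MatrixMultiplication.Theses.PriceOfSymmetry.<Decl> := …` in Summits/MatrixMultiplication/MatrixMultiplication/Theorems/<Name>.lean.
-/

namespace Summit.MatrixMultiplication.MatrixMultiplication.Theses.PriceOfSymmetry

open scoped BigOperators Topology Manifold Classical MeasureTheory ProbabilityTheory Matrix InnerProductSpace ComplexConjugate ContinuousMap
open Filter Set Function TopologicalSpace MeasureTheory

attribute [summit_statement] _root_.MatrixMultiplication

/-- item stmt-MatrixMultiplication-6823 · target · rank 0 · closed · moot by None · by planner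
why it might fail: the lower half fails if a weight-1/2 core design exists (constant 1/2, decidable by Gröbner); the upper half now rests on exact Q(ω) cores and can fail only in the n-uniform bookkeeping of the 2-label repair layer.
sources: GrochowMoore2016, Landsberg2017, doi:10.1109/SFCS.1978.34, DixonMortimer1996
[target] X = UPPER ∧ LOWER as in § Thesis: symmetric schemes with ≤ (2/3)n³ + K n² triads exist for
all large n, and every symmetric scheme has ≥ (2/3)n³ − K n² triads for all large n. -/
@[route_item "route-MatrixMultiplication-PriceOfSymmetry"]
def PriceIsTwoThirds : Prop :=
  (∃ (K : ℝ) (n₀ : ℕ), ∀ n : ℕ, n₀ ≤ n → ∃ (r : ℕ) (w u v : Fin r → Fin n × Fin n → ℂ), (∀ σ : Equiv.Perm (Fin n), ∃ π : Equiv.Perm (Fin r), ∀ i, ∀ p q s : Fin n × Fin n, Literature.Computability.AlgebraicComplexity.triad (w (π i)) (u (π i)) (v (π i)) (σ p.1, σ p.2) (σ q.1, σ q.2) (σ s.1, σ s.2) = Literature.Computability.AlgebraicComplexity.triad (w i) (u i) (v i) p q s) ∧ ∑ i, Literature.Computability.AlgebraicComplexity.triad (w i) (u i) (v i) = Literature.Computability.AlgebraicComplexity.matMulTensor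 ℂ n n n ∧ (r : ℝ) ≤ (2 / 3 : ℝ) * (n : ℝ) ^ 3 + K * (n : ℝ) ^ 2) ∧ (∃ (K : ℝ) (n₀ : ℕ), ∀ n : ℕ, n₀ ≤ n → ∀ (r : ℕ) (w u v : Fin r → Fin n × Fin n → ℂ), (∀ σ : Equiv.Perm (Fin n), ∃ π : Equiv.Perm (Fin r), ∀ i, ∀ p q s : Fin n × Fin n, Literature.Computability.AlgebraicComplexity.triad (w (π i)) (u (π i)) (v (π i)) (σ p.1, σ p.2) (σ q.1, σ q.2) (σ s.1, σ s.2) = Literature.Computability.AlgebraicComplexity.triad (w i) (u i) (v i) p q s) → ∑ i, Literature.Computability.AlgebraicComplexity.triad (w i) (u i) (v i) = Literature.Computability.AlgebraicComplexity.matMulTensor ℂ n n n → (2 / 3 : ℝ) * (n : ℝ) ^ 3 - K * (n : ℝ) ^ 2 ≤ (r : ℝ))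

/-- item stmt-MatrixMultiplication-6824 · crux · rank 2 · closed · moot by None · by planner
why it might fail: a weight-1/2 core design (one Z_2-symmetric 3-label orbit, or an S_3-orbit plus a Z_3-orbit) may exist although Levenberg–Marquardt stalls at residual 0.707 / 0.603 from 40+ random starts (fi/heavy_search.out); then the constant is 1/2. Decidable by Gröbner over Q(ω).
sources: GrochowMoore2016, doi:10.1109/SFCS.1978.34, Landsberg2017, DixonMortimer1996
[crux] LOWER: there are K, n₀ such that for n ≥ n₀ every S_n-symmetric scheme for ⟨n,n,n⟩ has at
least (2/3)n³ − K n² triads. Route to it (layer 2, not filed): orbits of size < C(n,4) are ≤3-label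
(SmallOrbitsFewLabels with c = 3); modulo the 2-label span V₂ only 3×3 cores count; exclude core
designs of total weight 1/6, 1/3, 1/2 (finitely many polynomial systems over Q(ω); 1/6 already
excluded linearly at the desk). [deps: SymmetricSchemesCubic, SmallOrbitsFewLabels,
TwoLabelSpanMisses] [difficulty: L] -/
@[route_item "route-MatrixMultiplication-PriceOfSymmetry"]
def PriceOfSymmetryLower : Prop :=
  ∃ (K : ℝ) (n₀ : ℕ), ∀ n : ℕ, n₀ ≤ n → ∀ (r : ℕ) (w u v : Fin r → Fin n × Fin n → ℂ), (∀ σ : Equiv.Perm (Fin n), ∃ π : Equiv.Perm (Fin r), ∀ i, ∀ p q s : Fin n × Fin n, Literature.Computability.AlgebraicComplexity.triad (w (π i)) (u (π i)) (v (π i)) (σ p.1, σ p.2) (σ q.1, σ q.2) (σ s.1, σ s.2) = Literature.Computability.AlgebraicComplexity.triad (w i) (u i) (v i) p q s) → ∑ i, Literature.Computability.AlgebraicComplexity.triad (w i) (u i) (v i) = Literature.Computability.AlgebraicComplexity.matMulTensor ℂ n n n → (2 / 3 : ℝ) * (n : ℝ) ^ 3 - K * (n : ℝ) ^ 2 ≤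 (r : ℝ)

/-- item stmt-MatrixMultiplication-6825 · crux · rank 3 · closed · moot by None · by planner
why it might fail: rests on the desk certificate λ (±1 on 20 patterns, verified exactly at n = 6..1000) and on Dixon–Mortimer 5.2B; a slot-convention slip between the orbit model and matMulTensor, or the n = 8 index-35 exceptions (S_4≀S_2, AGL(3,2)) leaking past n₀, would break the stated form.
sources: DixonMortimer1996, arXiv:1204.4533, arXiv:2002.06451, GrochowMoore2016
[crux] THE BARRIER CORE (mechanism's theorem, provable now): there is n₀ (expected n₀ = 10) such
that for n ≥ n₀ every S_n-symmetric scheme for ⟨n,n,n⟩ has at least C(n,3) = n(n−1)(n−2)/6 triads.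
Hence every family of schemes functorial in n has term count ≥ n³/6 − O(n²) and certifies no
exponent below 3 (card item B1 + CEF corollary). Proof plan: symmetrisation identity Σ t_i = (1/n!)
Σ_i Sym(t_i); if r < C(n,3) all terms are ≤2-label (SmallOrbitsFewLabels c = 2,
FixedTriadFixedLegs); contradiction with TwoLabelSpanMisses. [deps: TwoLabelSpanMisses,
SmallOrbitsFewLabels, FixedTriadFixedLegs] [difficulty: M] -/
@[route_item "route-MatrixMultiplication-PriceOfSymmetry"]
def SymmetricSchemesCubic : Prop :=
  ∃ n₀ : ℕ, ∀ n : ℕ, n₀ ≤ n → ∀ (r : ℕ) (w u v : Fin r → Fin n × Fin n → ℂ), (∀ σ : Equiv.Perm (Fin n), ∃ π : Equiv.Perm (Fin r), ∀ i, ∀ p q s : Fin n × Fin n, Literature.Computability.AlgebraicComplexity.triad (w (π i)) (u (π i)) (v (π i)) (σ p.1, σ p.2) (σ q.1, σ q.2) (σ s.1, σ s.2) = Literature.Computability.AlgebraicComplexity.triad (w i) (u i) (v i) p q s) → ∑ i, Literature.Computability.AlgebraicComplexity.triad (w i) (u i) (v i) = Literature.Computability.AlgebraicComplexity.matMulTensor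 ℂ n n n → n.choose 3 ≤ r

/-- item stmt-MatrixMultiplication-6826 · crux · rank 4 · closed · moot by None · by planner
why it might fail: exact Q(ω) cores are in hand; what can still fail is formal: the V₂-remainder must be expanded in 2-label orbit sums with coefficients rational in n (finitely many poles, absorbed into n₀), each realised by rank-one triads counted ≤ K n² — near-zero mathematical risk, real bookkeeping.
sources: GrochowMoore2016, doi:10.1109/SFCS.1978.34, Landsberg2017
[crux] UPPER (new construction, found numerically at the desk): there are K, n₀ such that for every
n ≥ n₀ there is an S_n-symmetric scheme for ⟨n,n,n⟩ with at most (2/3)n³ + K n² triads — two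
S_n-orbits of Z_3-symmetric rank-one 3-label templates (each orbit of size n(n−1)(n−2)/3; legs are
twisted circulants on the 3×3 label core, cube roots of unity needed) plus an O(n²) repair by ≤ 195
orbits of ≤2-label terms realising the V₂-remainder (fi/verify_design.py: residual 10⁻¹² against the
exact annihilators). [deps: TwoLabelSpanMisses] [difficulty: M] -/
@[route_item "route-MatrixMultiplication-PriceOfSymmetry"]
def SymmetricTwoThirdsScheme : Prop :=
  ∃ (K : ℝ) (n₀ : ℕ), ∀ n : ℕ, n₀ ≤ n → ∃ (r : ℕ) (w u v : Fin r → Fin n × Fin n → ℂ), (∀ σ : Equiv.Perm (Fin n), ∃ π : Equiv.Perm (Fin r), ∀ i, ∀ p q s : Fin n × Fin n, Literature.Computability.AlgebraicComplexity.triad (w (π i)) (u (π i)) (v (π i)) (σ p.1, σ p.2) (σ q.1, σ q.2) (σ s.1, σ s.2) = Literature.Computability.AlgebraicComplexity.triad (w i) (u i) (v i) p q s) ∧ ∑ i, Literature.Computability.AlgebraicComplexity.triad (w i) (u i) (v i) = Literature.Computability.AlgebraicComplexity.matMulTensor ℂ n n n ∧ (r : ℝ) ≤ (2 / 3 : ℝ)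 * (n : ℝ) ^ 3 + K * (n : ℝ) ^ 2

-- item stmt-MatrixMultiplication-7310 · support · rank 5 · closed · moot by None · by planner — informal only, no Lean statement yet:
--   [crux] SymmetricCircuitsCubic (depth-unbounded strengthening of SymmetricSchemesCubic; untyped until
--   a SymmetricArithmeticCircuit definition lands): there is c > 0 such that for all large n every
--   S_n-SYMMETRIC arithmetic circuit over ℂ (Dawar–Wilsenach, arXiv:2002.06451 §3: the action of Γ = S_n
--   on the inputs A_{ij}, B_{jk} by simultaneous index relabelling extends to automorphisms of the
--   circuit DAG, outputs (AB)_{ik} permuted accordingly) computing the n×n matrix product has at least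
--   c·n³ gates. Bilinear schemes are the depth-2 case (there the bound C(n,3) is crux
--   SymmetricSchemesCubic). Pla

/-- item stmt-MatrixMultiplication-6827 · support · rank 9 · closed · moot by None · by planner
sources: arXiv:1204.4533, GrochowMoore2016
[support] the span theorem with certificate (card B1): for n ≥ 6, no complex combination of
S_n-symmetrisations of triads whose three legs are all fixed by the pointwise stabiliser of some
2-set {a,b} equals ⟨n,n,n⟩. Proof: the linear functional Λ(t) = Σ_P λ_P t(i^P) (λ ∈ {0,±1}^{203}
supported on 20 set partitions, fi/certificate_n_independent.json; i^P a representative 6-tuple of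
pattern P with values in {0,…,5}) kills every symmetrised ≤2-label triad (1000 orbit-type
generators; coordinates are polynomials of degree ≤ 2 in n, so vanishing at three n proves all n)
and Λ(⟨n,n,n⟩) = −1. [difficulty: provable-now] -/
@[route_item "route-MatrixMultiplication-PriceOfSymmetry"]
def TwoLabelSpanMisses : Prop :=
  ∀ n : ℕ, 6 ≤ n → ∀ (r : ℕ) (c : Fin r → ℂ) (w u v : Fin r → Fin n × Fin n → ℂ), (∀ i, ∃ a b : Fin n, ∀ σ : Equiv.Perm (Fin n), σ a = a → σ b = b → ∀ p : Fin n × Fin n, w i (σ p.1, σ p.2) = w i p ∧ u i (σ p.1, σ p.2) = u i p ∧ v i (σ p.1, σ p.2) = v i p) → (∑ i, c i • ∑ σ : Equiv.Perm (Fin n), (fun p q s : Fin n × Fin n => Literature.Computability.AlgebraicComplexity.triad (w i) (u i) (v i) (σ p.1, σ p.2) (σ q.1, σ q.2) (σ s.1, σ s.2))) ≠ Literature.Computability.AlgebraicComplexity.matMulTensor ℂ n n n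

/-- item stmt-MatrixMultiplication-6828 · support · rank 9 · closed · moot by None · by planner
sources: DixonMortimer1996
[support] small orbits force few labels (general tensors, parametric): for every c there is n₀ such
that for n ≥ n₀, if a list of r < C(n, c+1) order-6 tensors on Fin n is permuted by every
simultaneous index relabelling, then each tensor is fixed by the pointwise stabiliser of some set of
≤ c indices. Proof: the set of distinct tensors is S_n-stable, orbits have size ≤ r, so stabilisers
have index < C(n,c+1) and contain Alt on the complement of ≤ c points (DixonMortimer1996 Thm 5.2A/B,
c+1 ≤ n/2, exceptions only for n ≤ 8); Alt-fixed ⇒ Sym-fixed for order-6 tensors once n − c ≥ 8.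
[difficulty: M] -/
@[route_item "route-MatrixMultiplication-PriceOfSymmetry"]
def SmallOrbitsFewLabels : Prop :=
  ∀ c : ℕ, ∃ n₀ : ℕ, ∀ n : ℕ, n₀ ≤ n → ∀ (r : ℕ) (t : Fin r → (Fin n × Fin n → Fin n × Fin n → Fin n × Fin n → ℂ)), (∀ σ : Equiv.Perm (Fin n), ∃ π : Equiv.Perm (Fin r), ∀ i, ∀ p q s : Fin n × Fin n, t (π i) (σ p.1, σ p.2) (σ q.1, σ q.2) (σ s.1, σ s.2) = t i p q s) → r < n.choose (c + 1) → ∀ i, ∃ S : Finset (Fin n), S.card ≤ c ∧ ∀ σ : Equiv.Perm (Fin n), (∀ x ∈ S, σ x = x) → ∀ p q s : Fin n × Fin n, t i (σ p.1, σ p.2) (σ q.1, σ q.2) (σ s.1, σ s.2) = t i p q s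

/-- item stmt-MatrixMultiplication-6829 · support · rank 9 · closed · moot by None · by planner
sources: DixonMortimer1996
[support] for n ≥ 6, a NONZERO triad w ⊗ u ⊗ v (legs on Fin n × Fin n) fixed as a tensor by every σ
in the pointwise stabiliser of {a,b} has each leg fixed by that stabiliser (the legs transform by
characters of Sym([n]∖{a,b}) with product 1, and the sign character does not occur in ℂ^{[n]²} once
n − 2 ≥ 4). [difficulty: provable-now] -/
@[route_item "route-MatrixMultiplication-PriceOfSymmetry"]
def FixedTriadFixedLegs : Prop :=
  ∀ n : ℕ, 6 ≤ n → ∀ (a b : Fin n) (w u v : Fin n × Fin n → ℂ), Literature.Computability.AlgebraicComplexity.triad w u v ≠ 0 → (∀ σ : Equiv.Perm (Fin n), σ a = a → σ b = b → ∀ p q s : Fin n × Fin n, Literature.Computability.AlgebraicComplexity.triad w u v (σ p.1, σ p.2) (σ q.1, σ q.2) (σ s.1, σ s.2) = Literature.Computability.AlgebraicComplexity.triad w u v p q s) → ∀ σ : Equiv.Perm (Fin n), σ a = a → σ b = b → ∀ p : Fin n × Fin n, w (σ p.1, σ p.2) = w p ∧ u (σ p.1, σ p.2) = u p ∧ v (σ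 p.1, σ p.2) = v p

/-- item stmt-MatrixMultiplication-6830 · assembly · rank 1 · closed · moot by None · by planner
sources: GrochowMoore2016, DixonMortimer1996
[assembly] SymmetricTwoThirdsScheme → PriceOfSymmetryLower → PriceIsTwoThirds. -/
@[route_item "route-MatrixMultiplication-PriceOfSymmetry"]
def Assembly : Prop :=
  SymmetricTwoThirdsScheme → PriceOfSymmetryLower → PriceIsTwoThirds

end Summit.MatrixMultiplication.MatrixMultiplication.Theses.PriceOfSymmetry
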